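import Mathlib
import Summits.Ventures.PercRepro2.Defs
import Summits.Ventures.PercRepro2.Graph
import Summits.Ventures.PercRepro2.Events
import Summits.Ventures.PercRepro2.Independence
import Summits.Ventures.PercRepro2.Harris

/-!
# The quantitative-Harris candidate `(L‴)` at a third vertex: its defect, pinning identity and
degenerate marks (blind cell PercRepro2, p2 g37)

For a root `a₂`, a vertex `z` and marks `o`, `b` write `K = C(a₂)`, `Z = {z ↔ a₂}`, `O = {o ↔ a₂}`,
`B = {b ↔ a₂}` and `W = {o ↔ z} ∩ {b ↔ z}` (o and b in the cluster of z).  The candidate row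
(2′L3, proofs/P2-G37-COV.md §8) is

  `(L‴)   Cov(O, B) ≥ P(Z) · P(Zᶜ ∩ W)`,

recorded here through its **defect** `l3Defect = P(O ∩ B) − P(O) P(B) − P(Z) P(Zᶜ ∩ W)` (so `(L‴)`
is `0 ≤ l3Defect`).  This file proves

* the **pinning identity** (`l3Defect_eq_pin`): for every edge `e`, with `t = p e`,
  `l3Defect p = t · l3Defect p[e↦1] + (1 − t) · l3Defect p[e↦0] + t (1 − t) · l3Cross p e`, where the
  cross term is `l3Cross = (ΔO)(ΔB) + (ΔZ)(Δ(Zᶜ ∩ W))`, `ΔX = P_{p[e↦1]} X − P_{p[e↦0]} X` — the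
  one-edge step of the induction «(L‴) ⟸ CROSS ≥ 0 at every edge incident to o or b» of the record;
* the degenerate marks: `o = a₂` gives defect `0` (`l3Defect_root_o`), `z = a₂` gives the Harris
  covariance (`l3Defect_root_z_nonneg`), and `o = z` gives `Cov(Z, B ∪ {b ↔ z}) ≥ 0` exactly
  (`l3Defect_o_eq_z`, `l3Defect_o_eq_z_nonneg`).

Std axioms.
-/

namespace Summit.Ventures.PercRepro2

namespace RowL3

section Defect

variable {V : Type*} {E : Type*} [Fintype E] [DecidableEq E] [Fintype V] [DecidableEq V]
  {R : Type*} [Field R] [LinearOrder R] [IsStrictOrderedRing R]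

/-- The event `Zᶜ ∩ W = {z ↮ a₂} ∩ {o ↔ z} ∩ {b ↔ z}`: `z` off the root cluster with `o` and `b` in
the cluster of `z`. -/
def offRootW (ends : E → Sym2 V) (a₂ z o b : V) : Set (Config E) :=
  (connEvent ends a₂ z)ᶜ ∩ (connEvent ends z o ∩ connEvent ends z b)

/-- The defect of `(L‴)`: `P(O ∩ B) − P(O) P(B) − P(Z) P(Zᶜ ∩ W)`. -/
noncomputable def l3Defect (p : E → R) (ends : E → Sym2 V) (a₂ z o b : V) : R :=
  prob p (connEvent ends a₂ o ∩ connEvent ends a₂ b) -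
    prob p (connEvent ends a₂ o) * prob p (connEvent ends a₂ b) -
    prob p (connEvent ends a₂ z) * prob p (offRootW ends a₂ z o b)

/-- The pinning cross term at an edge `e`: `(ΔO)(ΔB) + (ΔZ)(Δ(Zᶜ ∩ W))` with
`ΔX = P_{p[e↦1]} X − P_{p[e↦0]} X`. -/
noncomputable def l3Cross (p : E → R) (ends : E → Sym2 V) (a₂ z o b : V) (e : E) : R :=
  (prob (Function.update p e 1) (connEvent ends a₂ o) -
      prob (Function.update p e 0) (connEvent ends a₂ o)) *
    (prob (Function.update p e 1) (connEvent ends a₂ b) -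
      prob (Function.update p e 0) (connEvent ends a₂ b)) +
  (prob (Function.update p e 1) (connEvent ends a₂ z) -
      prob (Function.update p e 0) (connEvent ends a₂ z)) *
    (prob (Function.update p e 1) (offRootW ends a₂ z o b) -
      prob (Function.update p e 0) (offRootW ends a₂ z o b))

omit [Fintype V] [DecidableEq V] [LinearOrder R] [IsStrictOrderedRing R] in
/-- **The pinning identity for the defect**: with `t = p e`,
`l3Defect p = t · l3Defect p[e↦1] + (1 − t) · l3Defect p[e↦0] + t (1 − t) · l3Cross p e`. -/
theorem l3Defect_eq_pin (p : E → R) (ends : E → Sym2 V) (a₂ z o b : V) (e : E) :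
    l3Defect p ends a₂ z o b =
      p e * l3Defect (Function.update p e 1) ends a₂ z o b +
        (1 - p e) * l3Defect (Function.update p e 0) ends a₂ z o b +
        p e * (1 - p e) * l3Cross p ends a₂ z o b e := by
  have hOB := prob_eq_pin p (connEvent ends a₂ o ∩ connEvent ends a₂ b) e
  have hO := prob_eq_pin p (connEvent ends a₂ o) e
  have hB := prob_eq_pin p (connEvent ends a₂ b) e
  have hZ := prob_eq_pin p (connEvent ends a₂ z) e
  have hW := prob_eq_pin p (offRootW ends a₂ z o b) e
  unfold l3Defect l3Cross
  rw [hOB, hO, hB, hZ, hW]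
  ring

omit [Fintype E] [DecidableEq E] [Fintype V] [DecidableEq V] in
/-- `{a ↔ a}` is the sure event. -/
lemma connEvent_self_univ (ends : E → Sym2 V) (a : V) : connEvent ends a a = Set.univ :=
  Set.eq_univ_of_forall fun ω => conn_refl ends ω a

omit [Fintype E] [DecidableEq E] [Fintype V] [DecidableEq V] in
/-- For `o = a₂` the off-root event is empty: `a₂ ∈ C(z)` forces `z ↔ a₂`. -/
lemma offRootW_root_o (ends : E → Sym2 V) (a₂ z b : V) : offRootW ends a₂ z a₂ b = ∅ := by
  ext ω
  simp only [offRootW, Set.mem_inter_iff, Set.mem_compl_iff, mem_connEvent, Set.mem_empty_iff_false,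
    iff_false, not_and]
  intro h1 h2 _
  exact h1 (conn_symm h2)

omit [Fintype V] [DecidableEq V] [LinearOrder R] [IsStrictOrderedRing R] in
/-- The degenerate mark `o = a₂`: the defect vanishes. -/
theorem l3Defect_root_o (p : E → R) (ends : E → Sym2 V) (a₂ z b : V) :
    l3Defect p ends a₂ z a₂ b = 0 := by
  unfold l3Defect
  rw [offRootW_root_o, prob_empty, connEvent_self_univ, Set.univ_inter, prob_univ]
  ring

omit [Fintype E] [DecidableEq E] [Fintype V] [DecidableEq V] in
/-- For `z = a₂` the off-root event is empty. -/
lemma offRootW_root_z (ends : E → Sym2 V) (a₂ o b : V) : offRootW ends a₂ a₂ o b = ∅ := by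
  ext ω
  simp only [offRootW, Set.mem_inter_iff, Set.mem_compl_iff, mem_connEvent, Set.mem_empty_iff_false,
    iff_false, not_and]
  intro h1
  exact absurd (conn_refl ends ω a₂) h1

omit [Fintype V] [DecidableEq V] in
/-- The degenerate mark `z = a₂`: the defect is the Harris covariance `Cov(O, B) ≥ 0`. -/
theorem l3Defect_root_z_nonneg (p : E → R) (hp : IsProbVec p) (ends : E → Sym2 V) (a₂ o b : V) :
    0 ≤ l3Defect p ends a₂ a₂ o b := by
  unfold l3Defect
  rw [offRootW_root_z, prob_empty]
  have h := prob_mul_prob_le_prob_inter hp (isUpperSet_connEvent ends a₂ o)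
    (isUpperSet_connEvent ends a₂ b)
  linarith

omit [Fintype E] [DecidableEq E] [Fintype V] [DecidableEq V] in
/-- For `o = z` the off-root event is `{z ↮ a₂} ∩ {b ↔ z}`. -/
lemma offRootW_o_eq_z (ends : E → Sym2 V) (a₂ z b : V) :
    offRootW ends a₂ z z b = (connEvent ends a₂ z)ᶜ ∩ connEvent ends z b := by
  unfold offRootW
  rw [connEvent_self_univ, Set.univ_inter]

omit [Fintype E] [DecidableEq E] [Fintype V] [DecidableEq V] in
/-- `{b ↔ a₂} ∪ {b ↔ z}` meets `{z ↔ a₂}` exactly where `{b ↔ a₂}` does. -/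
lemma union_inter_conn_z (ends : E → Sym2 V) (a₂ z b : V) :
    (connEvent ends a₂ b ∪ connEvent ends z b) ∩ connEvent ends a₂ z =
      connEvent ends a₂ b ∩ connEvent ends a₂ z := by
  ext ω
  simp only [Set.mem_inter_iff, Set.mem_union, mem_connEvent]
  constructor
  · rintro ⟨h | h, hZ⟩
    · exact ⟨h, hZ⟩
    · exact ⟨conn_trans hZ h, hZ⟩
  · rintro ⟨h, hZ⟩
    exact ⟨Or.inl h, hZ⟩

omit [Fintype E] [DecidableEq E] [Fintype V] [DecidableEq V] in
/-- Off `{z ↔ a₂}` the events `{b ↔ a₂}` and `{b ↔ z}` are disjoint. -/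
lemma disjoint_conn_z_compl (ends : E → Sym2 V) (a₂ z b : V) :
    Disjoint (connEvent ends a₂ b ∩ (connEvent ends a₂ z)ᶜ)
      ((connEvent ends a₂ z)ᶜ ∩ connEvent ends z b) := by
  rw [Set.disjoint_left]
  rintro ω ⟨hB, hZ⟩ ⟨_, hzb⟩
  exact hZ (conn_trans hB (conn_symm hzb))

omit [Fintype V] [DecidableEq V] [LinearOrder R] [IsStrictOrderedRing R] in
/-- `P((B ∪ {b ↔ z}) ∩ Zᶜ) = P(B ∩ Zᶜ) + P(Zᶜ ∩ {b ↔ z})`. -/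
lemma prob_union_inter_compl_z (p : E → R) (ends : E → Sym2 V) (a₂ z b : V) :
    prob p ((connEvent ends a₂ b ∪ connEvent ends z b) ∩ (connEvent ends a₂ z)ᶜ) =
      prob p (connEvent ends a₂ b ∩ (connEvent ends a₂ z)ᶜ) +
        prob p ((connEvent ends a₂ z)ᶜ ∩ connEvent ends z b) := by
  rw [← prob_union_of_disjoint p (disjoint_conn_z_compl ends a₂ z b)]
  congr 1
  ext ω
  simp only [Set.mem_inter_iff, Set.mem_union, Set.mem_compl_iff]
  tauto

omit [Fintype V] [DecidableEq V] [LinearOrder R] [IsStrictOrderedRing R] in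
/-- **The degenerate mark `o = z`**: the defect is exactly the Harris covariance of `Z` and the
merged event `E_b = {b ↔ a₂} ∪ {b ↔ z}`:
`l3Defect = P(Z ∩ E_b) − P(Z) P(E_b)`. -/
theorem l3Defect_o_eq_z (p : E → R) (ends : E → Sym2 V) (a₂ z b : V) :
    l3Defect p ends a₂ z z b =
      prob p ((connEvent ends a₂ b ∪ connEvent ends z b) ∩ connEvent ends a₂ z) -
        prob p (connEvent ends a₂ z) * prob p (connEvent ends a₂ b ∪ connEvent ends z b) := by
  have hE := prob_inter_add_prob_inter_compl p (connEvent ends a₂ b ∪ connEvent ends z b)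
    (connEvent ends a₂ z)
  rw [union_inter_conn_z, prob_union_inter_compl_z] at hE
  have hB := prob_inter_add_prob_inter_compl p (connEvent ends a₂ b) (connEvent ends a₂ z)
  unfold l3Defect
  rw [offRootW_o_eq_z, union_inter_conn_z, ← hE, Set.inter_comm (connEvent ends a₂ z) (connEvent ends a₂ b),
    ← hB]
  ring

omit [Fintype V] [DecidableEq V] in
/-- The degenerate mark `o = z`: `(L‴)` holds, by Harris for `Z` and `E_b`. -/
theorem l3Defect_o_eq_z_nonneg (p : E → R) (hp : IsProbVec p) (ends : E → Sym2 V) (a₂ z b : V) :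
    0 ≤ l3Defect p ends a₂ z z b := by
  rw [l3Defect_o_eq_z]
  have h := prob_mul_prob_le_prob_inter hp
    ((isUpperSet_connEvent ends a₂ b).union (isUpperSet_connEvent ends z b))
    (isUpperSet_connEvent ends a₂ z)
  linarith

end Defect

end RowL3

end Summit.Ventures.PercRepro2
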